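import Summits.FinalStateConjecture.FinalStateConjecture.Theorems.UniversalWitnessFamily.Negative.MinkowskiSettled
import HarnessLib

/-!
# Stub `stub_minkowskiShell` (sanity) of line `inflow-ledger-open-system` of crux `Capture`
# (stmt-FinalStateConjecture-10115): ANTI-VACUITY OF SHELL — Minkowski space disperses outside
# `J⁺(K)` of every non-empty compact `K`

The line `inflow-ledger-open-system` of the crux `Capture` (routes `BartnikGapSettling` /
`QuietWindowCapture`, summit `FinalStateConjecture`) splits the crux into LEDGER / SHELL / OPEN /
UPGRADE.  SHELL (`ShellDisperses 𝒟`) says: for every compact `K` meeting the outer domain there is a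
late flat chart `Φ` on a coordinate domain `U₀ ⊇ H = {x⁰ > τ₀, |x̲| > x⁰ − c − 1}`, a late-time chart
into `J⁺(ι X)`, whose full `C²` deviation from `η` on the slabs `{x⁰ = τ} ∩ H` tends to `0`, whose
INNER COLLAR `{x⁰ > τ₀, x⁰ − c − 1 < |x̲| ≤ x⁰ − c}` is charted into `J⁺(K)`, and whose late image
obeys the usual covering clause.  This file proves the registered sanity stub `stub_minkowskiShell`
(verbatim signature): the body of `ShellDisperses` for the Minkowski development
`Minkowski.vacuumCauchyDevelopment` of the trivial datum `(ℝ³, δ, 0)`, with the hypothesis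
`MeetsOuterDomain 𝒟 K` replaced by `K.Nonempty` (which it implies).

Witnesses: `U₀ = ⊤`, `Φ = idFlatChart` (the identity chart of
`Theorems/UniversalWitnessFamily/Negative/MinkowskiSettled.lean`), `τ₀ = 0`, and
`c = k₀⁰ + |k̲₀|` for a chosen `k₀ ∈ K`.  Clause by clause: (1) `H ⊆ ⊤`; (2) the identity chart is
a late-time chart into `J⁺({x⁰ = 0}) = {x⁰ ≥ 0}` (`isLateChart_idFlatChart`,
`causalFuture_range_sliceEmbed`); (3) its extended deviation vanishes identically
(`deviationExtend_idFlatChart`), so every restricted `C²` sup norm is `0` (`supCkENorm_zero`);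
(4) a collar point `x` has `|x̲| ≤ x⁰ − k₀⁰ − |k̲₀|`, hence `|x̲ − k̲₀| ≤ |x̲| + |k̲₀| ≤ x⁰ − k₀⁰`, i.e.
`x ∈ J⁺(k₀) ⊆ J⁺(K)` (solid cones, `Minkowski.mem_causalFuture_vacuumCauchyDevelopment`);
(5) a point of `J⁺({x⁰ = 0}) ∩ I⁻({x⁰ > 0})` not in `{x⁰ > 0}` has `x⁰ = 0`, so it lies ON the
initial flat slab `{x⁰ = 0}`, hence in its causal past (`LorentzianMetric.subset_causalPast`; the
pattern of `minkowskiDecomp.diff_subset_causalPast`).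

No named facts are used and no definitions are introduced.  References: Hawking–Ellis 1973, §5.1
(Minkowski space); O'Neill 1983, Ch. 14, p. 402 (causality of `ℝ⁴₁`: `J⁺(p)` is the solid cone);
Christodoulou–Klainerman 1993, Thm. 1.0.2 (Minkowski space is its own final state: the archetype of
shell dispersal).
-/

-- the doubled `FinalStateConjecture.FinalStateConjecture` path component trips dupNamespace
set_option linter.dupNamespace false

noncomputable section

namespace Summit.FinalStateConjecture.FinalStateConjecture.Theorems.BartnikGapSettling.Capture

open Set Filter Topology TopologicalSpace
open scoped Manifold ContDiff ENNReal
open Literature.Geometry.Lorentzian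
-- `minkowskiExterior`, `idFlatChart` and their lemmas (the model point is settled)
open Summit.FinalStateConjecture.FinalStateConjecture.Theorems.UniversalWitnessFamily.Negative

/-- **The collar lies in the future cone of `k₀`.** If `|x̲| ≤ x⁰ − (k₀⁰ + |k̲₀|)` then
`|x̲ − k̲₀| ≤ |x̲| + |k̲₀| ≤ x⁰ − k₀⁰`, i.e. `x ∈ J⁺(k₀)` in the Minkowski development (solid future
cone, `Minkowski.causalFuture_singleton`). O'Neill 1983, Ch. 14, p. 402. [folklore] -/
private theorem mem_causalFuture_singleton_of_collar {k₀ x : E4}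
    (hx : E4.spatialNorm x ≤ x 0 - (k₀ 0 + E4.spatialNorm k₀)) :
    x ∈ Minkowski.vacuumCauchyDevelopment.metric.causalFuture
      Minkowski.vacuumCauchyDevelopment.timeOrientation ({k₀} : Set E4) := by
  refine Minkowski.mem_causalFuture_vacuumCauchyDevelopment ?_
  unfold E4.spatialNorm at hx
  calc ‖E4.spatial x - E4.spatial k₀‖ ≤ ‖E4.spatial x‖ + ‖E4.spatial k₀‖ := norm_sub_le _ _
    _ ≤ x 0 - k₀ 0 := by linarith

/-- **Anti-vacuity of SHELL** (sanity stub `stub_minkowskiShell` of line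
`inflow-ledger-open-system`, crux `Capture`, stmt-FinalStateConjecture-10115): the Minkowski
development `Minkowski.vacuumCauchyDevelopment` of the trivial datum `(ℝ³, δ, 0)` disperses outside
`J⁺(K)` of every NON-EMPTY compact `K` — the body of `ShellDisperses` with `MeetsOuterDomain`
replaced by `K.Nonempty`: identity chart on `U₀ = ⊤` after `τ₀ = 0` (a late-time chart into
`J⁺({x⁰ = 0}) = {x⁰ ≥ 0}` with identically vanishing deviation), collar
`{x⁰ − c − 1 < |x̲| ≤ x⁰ − c} ⊆ J⁺(k₀) ⊆ J⁺(K)` for `c = k₀⁰ + |k̲₀|`, `k₀ ∈ K` (solid cones), and the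
covering clause because a point of `{x⁰ ≥ 0}` not later than `0` lies ON the initial flat slab.
Hawking–Ellis 1973, §5.1 (Minkowski space); O'Neill 1983, Ch. 14, p. 402.
[cite: HawkingEllis1973, §5.1] -/
theorem stub_minkowskiShell :
    ∀ K : Set Minkowski.vacuumCauchyDevelopment.carrier, IsCompact K → K.Nonempty →
      ∃ (U₀ : TopologicalSpace.Opens E4) (Φ : U₀ → Minkowski.vacuumCauchyDevelopment.carrier)
        (τ₀ c : ℝ),
        {x : E4 | τ₀ < x 0 ∧ x 0 - c - 1 < E4.spatialNorm x} ⊆ (U₀ : Set E4) ∧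
        Minkowski.vacuumCauchyDevelopment.toSpacetime.IsLateChart (Minkowski.backgroundOn U₀)
          (Minkowski.vacuumCauchyDevelopment.metric.causalFuture
            Minkowski.vacuumCauchyDevelopment.timeOrientation
            (range Minkowski.vacuumCauchyDevelopment.embed)) τ₀ Φ ∧
        Tendsto (fun τ ↦ supCkENorm
            (Subtype.val '' {x : U₀ | x.1 0 = τ ∧ x.1 0 - c - 1 < E4.spatialNorm x.1}) 2
            (Minkowski.vacuumCauchyDevelopment.toSpacetime.deviationExtend
              (Minkowski.backgroundOn U₀) Φ)) atTop (𝓝 0) ∧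
        Φ '' {x : U₀ | τ₀ < x.1 0 ∧ x.1 0 - c - 1 < E4.spatialNorm x.1 ∧
            E4.spatialNorm x.1 ≤ x.1 0 - c} ⊆
          Minkowski.vacuumCauchyDevelopment.metric.causalFuture
            Minkowski.vacuumCauchyDevelopment.timeOrientation K ∧
        Summit.FinalStateConjecture.exteriorOf Minkowski.vacuumCauchyDevelopment.toCauchyDevelopment
            (Φ '' (Minkowski.backgroundOn U₀).lateRegion τ₀) \
            (Φ '' (Minkowski.backgroundOn U₀).lateRegion τ₀) ⊆
          Minkowski.vacuumCauchyDevelopment.metric.causalPast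
            Minkowski.vacuumCauchyDevelopment.timeOrientation
            (Φ '' (Minkowski.backgroundOn U₀).timeSlab τ₀) := by
  intro K _ hKne
  obtain ⟨k₀, hk₀⟩ : ∃ k₀ : E4, k₀ ∈ K := hKne
  refine ⟨⊤, idFlatChart, 0, k₀ 0 + E4.spatialNorm k₀, fun _ _ ↦ trivial, ?_, ?_, ?_, ?_⟩
  · -- (2) the identity chart is a late-time chart into `J⁺(ι ℝ³) = {x⁰ ≥ 0}`
    refine ⟨isLateChart_idFlatChart.contMDiff, isLateChart_idFlatChart.isOpenEmbedding, ?_⟩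
    intro x hx
    exact (Set.ext_iff.mp causalFuture_range_sliceEmbed x).mpr
      (isLateChart_idFlatChart.image_subset hx)
  · -- (3) the deviation of the identity chart vanishes identically
    have h0 : Minkowski.vacuumCauchyDevelopment.toSpacetime.deviationExtend
        (Minkowski.backgroundOn ⊤) idFlatChart = 0 :=
      deviationExtend_idFlatChart
    rw [h0]
    simp only [supCkENorm_zero]
    exact tendsto_const_nhds
  · -- (4) the inner collar lies in `J⁺(k₀) ⊆ J⁺(K)`
    rintro _ ⟨y, ⟨-, -, hy⟩, rfl⟩
    exact LorentzianMetric.causalFuture_mono (M := Minkowski.vacuumCauchyDevelopment.carrier)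
      (singleton_subset_iff.mpr hk₀) (mem_causalFuture_singleton_of_collar hy)
  · -- (5) covering: a point of `J⁺({x⁰ = 0})` not flat-late after `0` lies on the slab `{x⁰ = 0}`
    rintro (x : E4) ⟨⟨hxJ, -⟩, hxl⟩
    have hx0 : (0 : ℝ) ≤ x 0 := (Set.ext_iff.mp causalFuture_range_sliceEmbed x).mp hxJ
    have hxle : x 0 ≤ 0 := by
      refine not_lt.mp fun hlt ↦ hxl ?_
      have : x ∈ (idFlatChart '' (Minkowski.backgroundOn ⊤).lateRegion 0 : Set E4) := by
        rw [image_idFlatChart_lateRegion]; exact hlt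
      exact this
    refine LorentzianMetric.subset_causalPast _ _ _ ?_
    have : x ∈ (idFlatChart '' (Minkowski.backgroundOn ⊤).timeSlab 0 : Set E4) := by
      rw [image_idFlatChart_timeSlab]; exact le_antisymm hxle hx0
    exact this

end Summit.FinalStateConjecture.FinalStateConjecture.Theorems.BartnikGapSettling.Capture

end
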